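import Summits.AtomisticToContinuum.Crystallization.Theorems.OverbindingBudgetGradedBareness

/-!
# OverbindingBudget — the DEPTH KERNEL «the minimal counterexample has no deep bare pocket» (depth cut, part 2/3; helper `--supports stmt-31280`)

decomp-a2c lens 4, generation 18, part 2 of 3 (part 1 = `OverbindingBudgetGradedBareness`: `BareOnT`, `CleanlessExcessT`, `ShallowBearing`, K-g4
`bareOnT_transport`, K-g7 `crossAbsSmall`; part 3 = `OverbindingBudgetCleanlessCutDepth`: the cut and the node narrative).  Helper over LANDED files
only (`--supports stmt-31280`, waiver (w2)); nothing registered.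

**THE DEPTH KERNEL `shallowBearing_of_graded`** (complete): `CleanlessExcessT ⟹` for every `Y` satisfying, out of RDEF's standing hypotheses, only
TEND ∧ LB (level `e`), TWO-WAY UNIFORM RECURRENCE (verbatim), uniform discreteness, μ-stability (`IsMuGSC`) and covering radius `< 9/10`:
`ShallowBearing Y`.  «THE MINIMAL COUNTEREXAMPLE HAS NO DEEP BARE POCKET.»

Proof.  If `¬ShallowBearing Y`, some level `t₀ < 1/200` has arbitrarily deep `t₀`-bare balls around sites (`deepBalls_of_not_shallow`).  Constants, in
the NON-CIRCULAR order  `t₀ ↦ ε := min(δ/3, 1/1200) ↦ (κ, σ) := law(δ, t₁ := t₀ + 3ε) ↦ s := 2n ≥ max(ℓ₁(κ/32), 32σ/κ, 2) ↦ r := s + ε + 2 ↦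
L := L(r+2, ε)` (recurrence) `↦ D := 2L + s + 6, M := L + s + 3 ↦ η₀ := κs³/(64D³) ↦ k ≥ max(ℓ₂(η₀/4), ℓ₃(η₀/4), 2) ↦ ℓ := 2M + kD`.  A deep bare ball
of radius `≥ r + 2` around a site, replicated by recurrence within `L` of each of the `k³` grid points `c + (M + D·v)`, `v ∈ {0,…,k−1}³`, gives by
K-g4 `t₁`-bare balls `B̄(y_v, r)`, hence (K-g3b) `t₁`-bare coordinate s-cubes `Q_v = cube(c_v, s) ⊆ B̄(y_v, r)` inside the big cube `Q = cube(c, ℓ)`,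
pairwise DISJOINT (grid spacing `D > s + 2L`).  CHARGE IS ADDITIVE over the partition «k³ blocks `F_v = F_Q ∩ Q_v` + rest `R`» of the cube's sites
(`sum_sum_blocks`, `card_blocks`; the site potential is split ONCE at `F_Q` by the landed `stub_siteSumSplit`, so nothing is double counted): the graded
law on the convex body `Q_v` (`B̄(c_v,s/2·…)`-sandwiched, `R := s`) charges each block `ΣΣ_{F_v} V ≥ 2(e+κ)#F_v − 2σs²`; the rest obeys `ΣΣ_R V ≥ 2e·#R`
(landed `stub_pairSumLowerBound`); each of the `k³` cross sums block × (cube ∖ block) is `≥ −(κ/32)s³` (K-g7 at side `s`), the cube × outside tail is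
`≥ −(η₀/4)ℓ³` (landed `stub_crossTermSmall`), and `#F_v ≥ s³/8` (landed `grid_lower_bound`, covering radius `9/10`).  With `s ≥ 32σ/κ` the cube's site
charge `Σ_{F_Q}(φ − 2e)` is `≥ k³(κs³/4 − 2σs² − κs³/16) − (η₀/4)ℓ³ ≥ k³κs³/8 − (η₀/4)ℓ³ ≥ (3/4)η₀ℓ³` (as `ℓ ≤ 2kD`), while the landed `cubeChargeLaw`
(μ-stability, stmt-30251, at `η₀/4`) caps it by `(η₀/4)ℓ³` for `ℓ ≥ ℓ₃` — contradiction.  (The per-site tail route `−Cρ⁻³` would be circular — the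
required depth would have to beat `L(s)/s` — and is NOT used: only finite-sum bookkeeping and the two landed cube tails.)

§C1–C4 = finite-sum bookkeeping (`sum_sum_blocks`, `card_blocks`) and `deepBalls_of_not_shallow`.  Deps (tree only): part 1; `…CubeChargeLaw`,
`…CubeBookkeeping`, `…BindingSignLaw` (`grid_lower_bound`), `…ExcessInstability` (`finite_inter_cube`), `…WallTensionLever`, `…CubeTails`.
-/

namespace Summit.AtomisticToContinuum.Crystallization.Theorems.OverbindingBudgetDeepBareExclusion

open scoped BigOperators Topology
open Literature.MathematicalPhysics.StatisticalMechanics (UniformlyDiscrete IsMuGSC lennardJones groundStateEnergy)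
open Literature.Geometry.DiscreteGeometry (ShellCloseTo fccKissingPattern hcpKissingPattern EtaMatched)
open Summit.AtomisticToContinuum.Crystallization.Theses.OverbindingBudget (RobustDefectLimitWindows CubeChargeLaw)
open Summit.AtomisticToContinuum.Crystallization.Theorems.OverbindingBudgetViolatorDensityFloor (GT)
open Summit.AtomisticToContinuum.Crystallization.Theorems.OverbindingBudgetWallTensionLever (BarlowClose MAT CleanT ThinCores cube_convex closedBall_subset_cube cube_subset_closedBall)
open Summit.AtomisticToContinuum.Crystallization.Theorems.OverbindingBudgetExcessInstability (finite_inter_cube)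
open Summit.AtomisticToContinuum.Crystallization.Theorems.OverbindingBudgetPatchTransport (cleanT_transport)
open Summit.AtomisticToContinuum.Crystallization.Theorems.OverbindingBudgetCubeChargeLaw (cubeChargeLaw stub_crossTermSmall)
open Summit.AtomisticToContinuum.Crystallization.Theorems.OverbindingBudgetCubeBookkeeping (stub_siteSumSplit stub_pairSumLowerBound)
open Summit.AtomisticToContinuum.Crystallization.Theorems.OverbindingBudgetBindingSignLaw (grid_lower_bound)
open Summit.AtomisticToContinuum.Crystallization.Theorems.OverbindingBudgetCubeTails (sum_abs_lennardJones_le_dyadic card_le_of_separated_of_box card_slab_le)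
open Summit.AtomisticToContinuum.Crystallization.Theorems.OverbindingBudgetCleanlessCut (Hosted HostedTarget UnhostedResidual CleanBearing CleanlessPiece CleanBearingResidual BareOn CleanlessExcess margin_le_of_cleanT unhostedResidual_iff_pieces cleanlessPiece_of_cleanlessExcess rdef_iff_three rdef_iff_hosted_unhosted thinCores_of_cleanT_recurrent torn_or_thick_of_unhosted hosted_mono unhostedResidual_of_law_residual cleanT_clean cleanBearingResidual_mono bareOn_of_not_cleanBearing finiteDepth_of_cleanBearing)
open Summit.AtomisticToContinuum.Crystallization.Theorems.OverbindingBudgetGradedBareness (BareOnT CleanlessExcessT ShallowBearing bareOnT_of_bareOn cleanlessExcess_of_graded cleanT_anti bareOnT_mono bareOnT_subset bareOnT_transport CrossAbsSmall crossAbsSmall)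

/-! ## §C The depth kernel -/

/-- **C1 (double sums are bounded below by minus the absolute double sum).** -/
theorem neg_sum_sum_abs_le (A B : Finset (EuclideanSpace ℝ (Fin 3))) (f : EuclideanSpace ℝ (Fin 3) → EuclideanSpace ℝ (Fin 3) → ℝ) :
    -(∑ y ∈ A, ∑ w ∈ B, |f y w|) ≤ ∑ y ∈ A, ∑ w ∈ B, f y w := by
  rw [← Finset.sum_neg_distrib]
  refine Finset.sum_le_sum (fun y _ => ?_)
  rw [← Finset.sum_neg_distrib]
  exact Finset.sum_le_sum (fun w _ => neg_abs_le _)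

/-- **C2 (symmetry of the pair sum).** -/
theorem sum_sum_lennardJones_comm (A B : Finset (EuclideanSpace ℝ (Fin 3))) :
    ∑ y ∈ A, ∑ w ∈ B, lennardJones (dist y w) = ∑ w ∈ B, ∑ y ∈ A, lennardJones (dist w y) := by
  rw [Finset.sum_comm]
  exact Finset.sum_congr rfl (fun w _ => Finset.sum_congr rfl (fun y _ => by rw [dist_comm]))

/-- **C3 (block decomposition of a double sum).**  For pairwise disjoint blocks `B v ⊆ F` with rest `R := F ∖ ⋃ B v`:
`ΣΣ_F f = [ΣΣ_R f + Σ_v Σ_{R} Σ_{B v} f] + Σ_v [ΣΣ_{B v} f + Σ_{B v} Σ_{F ∖ B v} f]`. -/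
theorem sum_sum_blocks {ι : Type*} [Fintype ι] [DecidableEq (EuclideanSpace ℝ (Fin 3))] (F : Finset (EuclideanSpace ℝ (Fin 3)))
    (B : ι → Finset (EuclideanSpace ℝ (Fin 3))) (hB : ∀ v, B v ⊆ F) (hd : ∀ v w, v ≠ w → Disjoint (B v) (B w))
    (f : EuclideanSpace ℝ (Fin 3) → EuclideanSpace ℝ (Fin 3) → ℝ) :
    ∑ y ∈ F, ∑ w ∈ F, f y w =
      (∑ y ∈ F \ Finset.univ.biUnion B, ∑ w ∈ F \ Finset.univ.biUnion B, f y w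
        + ∑ v, ∑ y ∈ F \ Finset.univ.biUnion B, ∑ w ∈ B v, f y w)
      + ∑ v, (∑ y ∈ B v, ∑ w ∈ B v, f y w + ∑ y ∈ B v, ∑ w ∈ F \ B v, f y w) := by
  have hU : Finset.univ.biUnion B ⊆ F := Finset.biUnion_subset.2 (fun v _ => hB v)
  have hpd : (↑(Finset.univ : Finset ι) : Set ι).PairwiseDisjoint B := fun v _ w _ hvw => hd v w hvw
  have hrow : ∀ g : EuclideanSpace ℝ (Fin 3) → ℝ, ∑ y ∈ F, g y = ∑ y ∈ F \ Finset.univ.biUnion B, g y + ∑ v, ∑ y ∈ B v, g y := by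
    intro g
    rw [← Finset.sum_sdiff hU, Finset.sum_biUnion hpd]
  rw [hrow (fun y => ∑ w ∈ F, f y w)]
  congr 1
  · calc ∑ y ∈ F \ Finset.univ.biUnion B, ∑ w ∈ F, f y w
          = ∑ y ∈ F \ Finset.univ.biUnion B, (∑ w ∈ F \ Finset.univ.biUnion B, f y w + ∑ v, ∑ w ∈ B v, f y w) :=
            Finset.sum_congr rfl (fun y _ => hrow (fun w => f y w))
      _ = _ := by
            rw [Finset.sum_add_distrib]
            congr 1
            exact Finset.sum_comm
  · refine Finset.sum_congr rfl (fun v _ => ?_)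
    rw [← Finset.sum_add_distrib]
    refine Finset.sum_congr rfl (fun y _ => ?_)
    rw [← Finset.sum_sdiff (hB v), add_comm]

/-- **C3b (block decomposition of the count).** -/
theorem card_blocks {ι : Type*} [Fintype ι] [DecidableEq (EuclideanSpace ℝ (Fin 3))] (F : Finset (EuclideanSpace ℝ (Fin 3)))
    (B : ι → Finset (EuclideanSpace ℝ (Fin 3))) (hB : ∀ v, B v ⊆ F) (hd : ∀ v w, v ≠ w → Disjoint (B v) (B w)) :
    (F.card : ℝ) = ((F \ Finset.univ.biUnion B).card : ℝ) + ∑ v, ((B v).card : ℝ) := by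
  have hU : Finset.univ.biUnion B ⊆ F := Finset.biUnion_subset.2 (fun v _ => hB v)
  have h1 := Finset.card_sdiff_add_card_eq_card hU
  have h2 : (Finset.univ.biUnion B).card = ∑ v, (B v).card := Finset.card_biUnion (fun v _ w _ hvw => hd v w hvw)
  rw [h2] at h1
  exact_mod_cast h1.symm

/-- **C4 (a negated shallow-bearing level is a family of arbitrarily deep `t₀`-bare balls).** -/
theorem deepBalls_of_not_shallow {Y : Set (EuclideanSpace ℝ (Fin 3))} {t₀ : ℝ}
    (h : ¬ ∃ R : ℝ, ∀ c : EuclideanSpace ℝ (Fin 3), ∃ y ∈ Y, dist y c ≤ R ∧ ∃ a : ℝ, 47 / 50 ≤ a ∧ a ≤ 1 ∧ CleanT a t₀ Y y) :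
    ∀ R : ℝ, ∃ c : EuclideanSpace ℝ (Fin 3), BareOnT t₀ Y (Metric.closedBall c R) := by
  intro R
  by_contra hc
  push Not at hc
  apply h
  refine ⟨R, fun c => ?_⟩
  have h1 := hc c
  unfold BareOnT at h1
  push Not at h1
  obtain ⟨y, hy, a, ha1, ha2, hcl⟩ := h1
  exact ⟨y, hy.1, Metric.mem_closedBall.1 hy.2, a, ha1, ha2, hcl⟩

/-- **THE DEPTH KERNEL · `shallowBearing_of_graded` (K-depth).**  Under RDEF's standing hypotheses (TEND ∧ LB for the level `e`, two-way uniform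
recurrence, uniform discreteness, μ-stability, covering radius `< 9/10`) the graded law forces MARGIN-UNIFORM Barlow order: for every level
`t₀ ∈ (0, 1/200)` the `t₀`-robustly clean Barlow sites are `R`-dense.  PROOF (charge is additive, constants in non-circular order): if at level `t₀`
there are arbitrarily deep `t₀`-bare balls, recurrence (base point a site `p₀` at the centre of a deep bare ball, matching error
`ε = min(δ/3, 1/1200)`) puts a `(t₀+3ε)`-bare ball of radius `s + 2` within `L` of EVERY site (K-g4); in a big cube of side `ℓ = 2M + kD` a grid of
`k³` such balls at spacing `D = 2L + s + 6` carries `k³` pairwise disjoint bare s-cubes; the graded law charges each bare cube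
`ΣΣ_{F_v} V ≥ 2(e+κ)#F_v − 2σs²`, the rest of the cube obeys `ΣΣ_R V ≥ 2e·#R` (LB, `stub_pairSumLowerBound`), the cross sums between a bare cube and
everything else are `≥ −(κ/32)s³` each (`crossAbsSmall`), and `#F_v ≥ s³/8` (`grid_lower_bound`); so the site charge of the big cube is
`≥ k³·κs³/8 − (outer tail) ≥ (3/4)η₀ℓ³` with `η₀ = κs³/(64D³)`, contradicting the landed `cubeChargeLaw` (μ-stability) at tolerance `η₀/4`. -/
theorem shallowBearing_of_graded (hCE : CleanlessExcessT) {e : ℝ} (hT : Filter.Tendsto (fun N : ℕ => Literature.MathematicalPhysics.StatisticalMechanics.groundStateEnergy Literature.MathematicalPhysics.StatisticalMechanics.lennardJones 3 N / N) Filter.atTop (nhds e)) (hlb : (∀ N : ℕ, 0 < N → e ≤ Literature.MathematicalPhysics.StatisticalMechanics.groundStateEnergy Literature.MathematicalPhysics.StatisticalMechanics.lennardJones 3 N / N))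
    {Y : Set (EuclideanSpace ℝ (Fin 3))} (hrec : (∀ R ε : ℝ, 0 < ε → ∃ L : ℝ, ∀ p ∈ Y, ∀ q ∈ Y, ∃ q' ∈ Y, dist q' q ≤ L ∧ (∀ y ∈ Y, dist y p ≤ R → ∃ y' ∈ Y, dist (y' - q') (y - p) ≤ ε) ∧ (∀ y' ∈ Y, dist y' q' ≤ R → ∃ y ∈ Y, dist (y' - q') (y - p) ≤ ε))) (hUD : UniformlyDiscrete Y) (hμ : IsMuGSC lennardJones e Y)
    (hsolid : (∀ z : EuclideanSpace ℝ (Fin 3), ∃ w ∈ Y, dist z w < 9 / 10)) : ShallowBearing Y := by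
  classical
  intro t₀ ht₀ ht₀'
  by_contra hdeep
  have hballs := deepBalls_of_not_shallow hdeep
  -- ── constants, in non-circular order ──
  obtain ⟨δ, hδ, hsep⟩ := id hUD
  set ε : ℝ := min (δ / 3) (1 / 1200) with hεdef
  have hεδ3 : ε ≤ δ / 3 := min_le_left _ _
  have hε1200 : ε ≤ 1 / 1200 := min_le_right _ _
  have hε : 0 < ε := lt_min (by linarith) (by norm_num)
  have h2ε : 2 * ε < δ := by linarith
  have h100ε : 100 * ε ≤ 47 / 50 := by linarith
  have ht₁ : 0 < t₀ + 3 * ε := by linarith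
  have ht₁' : t₀ + 3 * ε < 1 / 100 := by linarith
  obtain ⟨κ, hκ, σ, hσ, hlaw⟩ := hCE e hT hlb δ hδ (t₀ + 3 * ε) ht₁ ht₁'
  have hη : 0 < κ / 32 := by positivity
  obtain ⟨ℓ₁, hℓ₁⟩ := crossAbsSmall Y hUD (κ / 32) hη
  -- the bare block side s = 2 n
  obtain ⟨n, hn⟩ := exists_nat_ge (max (max ℓ₁ (32 * σ / κ)) 2)
  have hn0 : (0 : ℝ) ≤ n := Nat.cast_nonneg n
  set s : ℝ := (n : ℝ) * 2 with hsdef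
  have hsn : (n : ℝ) ≤ s := by rw [hsdef]; linarith
  have hs2 : 2 ≤ s := ((le_max_right _ _).trans hn).trans hsn
  have hsℓ₁ : ℓ₁ ≤ s := (((le_max_left _ _).trans (le_max_left _ _)).trans hn).trans hsn
  have hsσ : 32 * σ / κ ≤ s := (((le_max_right _ _).trans (le_max_left _ _)).trans hn).trans hsn
  have hσs : 32 * σ ≤ κ * s := by
    rw [div_le_iff₀ hκ] at hsσ; linarith
  have hs0 : 0 < s := by linarith
  have hs1 : 1 ≤ s := by linarith
  -- the deep bare ball about a site, and recurrence at patch radius r + 2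
  set r : ℝ := s + ε + 2 with hrdef
  obtain ⟨L₀, hL₀⟩ := hrec (r + 2) ε hε
  set L : ℝ := max L₀ 0 with hLdef
  have hL0 : 0 ≤ L := le_max_right _ _
  have hLL : L₀ ≤ L := le_max_left _ _
  obtain ⟨c₀, hc₀⟩ := hballs (r + 1)
  obtain ⟨p₀, hp₀, hdp₀⟩ := hsolid c₀
  have hdp₀' : dist p₀ c₀ < 9 / 10 := by rwa [dist_comm] at hdp₀
  have hbare0 : BareOnT t₀ Y (Metric.closedBall p₀ r) := by
    refine bareOnT_subset (fun z hz => ?_) hc₀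
    rw [Metric.mem_closedBall] at hz ⊢
    linarith [dist_triangle z p₀ c₀]
  -- every site has a (t₀+3ε)-bare ball of radius s + 2 within distance L (K-g4)
  have hcopy : ∀ q ∈ Y, ∃ q' ∈ Y, dist q' q ≤ L ∧ BareOnT (t₀ + 3 * ε) Y (Metric.closedBall q' (s + 2)) := by
    intro q hq
    obtain ⟨q', hq', hdq, hA, hB⟩ := hL₀ p₀ hp₀ q hq
    refine ⟨q', hq', hdq.trans hLL, ?_⟩
    have hex₁ : ∀ p ∈ Y, dist p p₀ ≤ r + 2 → ∃ w ∈ Y, dist (p - p₀) (w - q') ≤ ε := by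
      intro p hp hd
      obtain ⟨w, hw, h⟩ := hA p hp hd
      exact ⟨w, hw, by rwa [dist_comm] at h⟩
    have hex₂ : ∀ w ∈ Y, dist w q' ≤ r + 2 → ∃ p ∈ Y, dist (p - p₀) (w - q') ≤ ε := by
      intro w hw hd
      obtain ⟨p, hp, h⟩ := hB w hw hd
      exact ⟨p, hp, by rwa [dist_comm] at h⟩
    have h := bareOnT_transport hsep hε.le h2ε h100ε hex₁ hex₂ ht₀.le (le_refl (r + 2)) hbare0
    have hr : r - ε = s + 2 := by rw [hrdef]; ring
    rwa [hr] at h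
  choose! Φ hΦY hΦd hΦbare using hcopy
  choose w hwY hwd using hsolid
  -- grid constants and the big cube
  set D : ℝ := 2 * L + s + 6 with hDdef
  set M : ℝ := L + s + 3 with hMdef
  have hD0 : 0 < D := by linarith
  have hD1 : 1 ≤ D := by linarith
  have hM0 : 0 ≤ M := by linarith
  have hMD : M ≤ D := by linarith
  set η₀ : ℝ := κ * s ^ 3 / (64 * D ^ 3) with hη₀def
  have hη₀ : 0 < η₀ := by positivity
  obtain ⟨ℓ₂, hℓ₂⟩ := stub_crossTermSmall Y hUD (η₀ / 4) (by positivity)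
  have hccl := cubeChargeLaw
  unfold CubeChargeLaw at hccl
  obtain ⟨ℓ₃, hℓ₃⟩ := hccl e hlb Y hUD hμ (η₀ / 4) (by positivity)
  obtain ⟨k, hk⟩ := exists_nat_ge (max (max ℓ₂ ℓ₃) 2)
  have hk2 : (2 : ℝ) ≤ k := (le_max_right _ _).trans hk
  have hkℓ₂ : ℓ₂ ≤ k := ((le_max_left _ _).trans (le_max_left _ _)).trans hk
  have hkℓ₃ : ℓ₃ ≤ k := ((le_max_right _ _).trans (le_max_left _ _)).trans hk
  set ℓ : ℝ := 2 * M + (k : ℝ) * D with hℓdef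
  have hkD : (k : ℝ) ≤ (k : ℝ) * D := le_mul_of_one_le_right (by linarith) hD1
  have hℓk : (k : ℝ) ≤ ℓ := by linarith
  have hℓ₂' : ℓ₂ ≤ ℓ := hkℓ₂.trans hℓk
  have hℓ₃' : ℓ₃ ≤ ℓ := hkℓ₃.trans hℓk
  have hℓ0 : 0 < ℓ := by linarith
  have hℓ2kD : ℓ ≤ 2 * ((k : ℝ) * D) := by
    have h : 2 * D ≤ (k : ℝ) * D := mul_le_mul_of_nonneg_right hk2 hD0.le
    linarith only [h, hMD, hℓdef]
  obtain ⟨c⟩ : Nonempty (EuclideanSpace ℝ (Fin 3)) := ⟨0⟩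
  have hfin := finite_inter_cube hUD c hℓ0.le
  set FQ : Finset (EuclideanSpace ℝ (Fin 3)) := hfin.toFinset with hFQdef
  have hFQ : (↑FQ : Set (EuclideanSpace ℝ (Fin 3))) = Y ∩ {z | ∀ i : Fin 3, c i ≤ z i ∧ z i < c i + ℓ} := hfin.coe_toFinset
  have hFQY : (↑FQ : Set (EuclideanSpace ℝ (Fin 3))) ⊆ Y := by rw [hFQ]; exact Set.inter_subset_left
  have hFQmem : ∀ z ∈ FQ, z ∈ Y ∧ ∀ i : Fin 3, c i ≤ z i ∧ z i < c i + ℓ := by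
    intro z hz
    have hz' : z ∈ (↑FQ : Set (EuclideanSpace ℝ (Fin 3))) := Finset.mem_coe.2 hz
    rw [hFQ] at hz'
    exact hz'
  -- the grid, the block centres (sites), the block corners
  obtain ⟨g, hg⟩ : ∃ g : (Fin 3 → Fin k) → EuclideanSpace ℝ (Fin 3), ∀ v i, g v i = c i + (M + D * ((v i : ℕ) : ℝ)) :=
    ⟨fun v => c + WithLp.toLp 2 (fun i => M + D * ((v i : ℕ) : ℝ)), fun v i => by simp⟩
  obtain ⟨yv, hyv⟩ : ∃ yv : (Fin 3 → Fin k) → EuclideanSpace ℝ (Fin 3), ∀ v, yv v = Φ (w (g v)) := ⟨_, fun v => rfl⟩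
  have hyvY : ∀ v, yv v ∈ Y := fun v => by rw [hyv]; exact hΦY _ (hwY _)
  have hyvd : ∀ v, dist (yv v) (g v) ≤ L + 1 := by
    intro v
    have h1 := hΦd (w (g v)) (hwY (g v))
    have h2 := hwd (g v)
    rw [dist_comm] at h2
    rw [hyv]
    linarith [dist_triangle (Φ (w (g v))) (w (g v)) (g v)]
  have hyvc : ∀ v i, |yv v i - g v i| ≤ L + 1 := fun v i =>
    ((Real.dist_eq (yv v i) (g v i)).symm.le.trans (PiLp.dist_apply_le (yv v) (g v) i)).trans (hyvd v)
  have hyvbare : ∀ v, BareOnT (t₀ + 3 * ε) Y (Metric.closedBall (yv v) (s + 2)) := fun v => by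
    rw [hyv]; exact hΦbare _ (hwY _)
  obtain ⟨cv, hcv, hcv'⟩ : ∃ cv : (Fin 3 → Fin k) → EuclideanSpace ℝ (Fin 3), (∀ v i, cv v i = yv v i - s / 2) ∧
      (∀ v, cv v + WithLp.toLp 2 (fun _ : Fin 3 => s / 2) = yv v) :=
    ⟨fun v => yv v - WithLp.toLp 2 (fun _ : Fin 3 => s / 2), fun v i => by simp, fun v => sub_add_cancel _ _⟩
  have hvk : ∀ (v : Fin 3 → Fin k) (i : Fin 3), ((v i : ℕ) : ℝ) + 1 ≤ k := fun v i => by exact_mod_cast (v i).isLt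
  have hv0 : ∀ (v : Fin 3 → Fin k) (i : Fin 3), (0 : ℝ) ≤ ((v i : ℕ) : ℝ) := fun v i => Nat.cast_nonneg _
  -- block cubes lie in the big cube
  have hQvQ : ∀ v, ∀ z : EuclideanSpace ℝ (Fin 3), (∀ i : Fin 3, cv v i ≤ z i ∧ z i < cv v i + s) → ∀ i : Fin 3, c i ≤ z i ∧ z i < c i + ℓ := by
    intro v z hz i
    obtain ⟨hz1, hz2⟩ := hz i
    have h1 := hcv v i
    have h2 := hg v i
    have h3 := abs_le.1 (hyvc v i)
    have h4 := hvk v i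
    have h5 := hv0 v i
    have h6 : D * ((v i : ℕ) : ℝ) ≤ D * ((k : ℝ) - 1) := mul_le_mul_of_nonneg_left (by linarith) hD0.le
    have h7 : 0 ≤ D * ((v i : ℕ) : ℝ) := mul_nonneg hD0.le h5
    constructor
    · linarith only [hz1, h1, h2, h3.1, h7, hMdef, hL0, hs0]
    · linarith only [hz2, h1, h2, h3.2, h6, hMdef, hDdef, hℓdef, hL0, hs0]
  -- the blocks
  obtain ⟨Fv, hFv⟩ : ∃ Fv : (Fin 3 → Fin k) → Finset (EuclideanSpace ℝ (Fin 3)),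
      ∀ v, Fv v = FQ.filter (fun z => ∀ i : Fin 3, cv v i ≤ z i ∧ z i < cv v i + s) := ⟨_, fun v => rfl⟩
  have hFvsub : ∀ v, Fv v ⊆ FQ := fun v => by rw [hFv]; exact Finset.filter_subset _ _
  have hFvmem : ∀ v z, z ∈ Fv v ↔ z ∈ FQ ∧ ∀ i : Fin 3, cv v i ≤ z i ∧ z i < cv v i + s := fun v z => by rw [hFv, Finset.mem_filter]
  have hFvc : ∀ v, (↑(Fv v) : Set (EuclideanSpace ℝ (Fin 3))) = Y ∩ {z | ∀ i : Fin 3, cv v i ≤ z i ∧ z i < cv v i + s} := by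
    intro v
    ext z
    rw [Finset.mem_coe, hFvmem, Set.mem_inter_iff, Set.mem_setOf_eq]
    constructor
    · rintro ⟨hzF, hz⟩
      exact ⟨(hFQmem z hzF).1, hz⟩
    · rintro ⟨hzY, hz⟩
      refine ⟨?_, hz⟩
      rw [← Finset.mem_coe, hFQ]
      exact ⟨hzY, hQvQ v z hz⟩
  have hdisj : ∀ v v', v ≠ v' → Disjoint (Fv v) (Fv v') := by
    intro v v' hvv'
    rw [Finset.disjoint_left]
    intro z hz hz'
    obtain ⟨i, hi⟩ : ∃ i, v i ≠ v' i := by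
      by_contra h
      push Not at h
      exact hvv' (funext h)
    have hne : (v i : ℕ) ≠ (v' i : ℕ) := fun h => hi (Fin.ext h)
    obtain ⟨hz1, hz2⟩ := ((hFvmem v z).1 hz).2 i
    obtain ⟨hz1', hz2'⟩ := ((hFvmem v' z).1 hz').2 i
    have h1 := hcv v i
    have h1' := hcv v' i
    have h2 := hg v i
    have h2' := hg v' i
    have h3 := abs_le.1 (hyvc v i)
    have h3' := abs_le.1 (hyvc v' i)
    rcases Nat.lt_or_gt_of_ne hne with hlt | hlt
    · have hc : ((v i : ℕ) : ℝ) + 1 ≤ ((v' i : ℕ) : ℝ) := by exact_mod_cast hlt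
      have h6 : D * (((v i : ℕ) : ℝ) + 1) ≤ D * ((v' i : ℕ) : ℝ) := mul_le_mul_of_nonneg_left hc hD0.le
      linarith only [hz1', hz2, h1, h1', h2, h2', h3.2, h3'.1, h6, hDdef]
    · have hc : ((v' i : ℕ) : ℝ) + 1 ≤ ((v i : ℕ) : ℝ) := by exact_mod_cast hlt
      have h6 : D * (((v' i : ℕ) : ℝ) + 1) ≤ D * ((v i : ℕ) : ℝ) := mul_le_mul_of_nonneg_left hc hD0.le
      linarith only [hz1, hz2', h1, h1', h2, h2', h3.1, h3'.2, h6, hDdef]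
  -- ── the rest region and the five bounds ──
  set Rst : Finset (EuclideanSpace ℝ (Fin 3)) := FQ \ Finset.univ.biUnion Fv with hRstdef
  have hRstY : ∀ v, (↑Rst : Set (EuclideanSpace ℝ (Fin 3))) ⊆ Y \ ↑(Fv v) := by
    intro v z hz
    rw [Finset.mem_coe, hRstdef, Finset.mem_sdiff] at hz
    refine ⟨hFQY (Finset.mem_coe.2 hz.1), fun hz' => hz.2 ?_⟩
    rw [Finset.mem_biUnion]
    exact ⟨v, Finset.mem_univ _, hz'⟩
  -- (i) the rest region is a finite configuration: LB
  have hRR : 2 * e * (Rst.card : ℝ) ≤ ∑ y ∈ Rst, ∑ w ∈ Rst, lennardJones (dist y w) := stub_pairSumLowerBound e hlb Rst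
  -- (ii) cross sums rest × block
  have hRv : ∀ v, -(κ / 32 * s ^ 3) ≤ ∑ y ∈ Rst, ∑ w ∈ Fv v, lennardJones (dist y w) := by
    intro v
    have h := hℓ₁ s (cv v) hsℓ₁ (Fv v) (hFvc v) Rst (hRstY v)
    rw [sum_sum_lennardJones_comm]
    linarith [neg_sum_sum_abs_le (Fv v) Rst (fun y w => lennardJones (dist y w))]
  -- (iii) the graded law on each bare block
  have hvv : ∀ v, (e + κ) * ((Fv v).card : ℝ) - σ * s ^ 2 ≤ 1 / 2 * ∑ y ∈ Fv v, ∑ w ∈ Fv v, lennardJones (dist y w) := by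
    intro v
    have hball : Metric.closedBall (yv v) (s / 4) ⊆ {z : EuclideanSpace ℝ (Fin 3) | ∀ i : Fin 3, cv v i ≤ z i ∧ z i < cv v i + s} := by
      have h := closedBall_subset_cube (cv v) hs0
      rwa [hcv' v] at h
    have hcube : {z : EuclideanSpace ℝ (Fin 3) | ∀ i : Fin 3, cv v i ≤ z i ∧ z i < cv v i + s} ⊆ Metric.closedBall (yv v) s := by
      have h := cube_subset_closedBall (cv v) hs0.le
      rwa [hcv' v] at h
    have hbareQ : BareOnT (t₀ + 3 * ε) Y {z : EuclideanSpace ℝ (Fin 3) | ∀ i : Fin 3, cv v i ≤ z i ∧ z i < cv v i + s} :=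
      bareOnT_subset (hcube.trans (Metric.closedBall_subset_closedBall (by linarith))) (hyvbare v)
    exact hlaw Y hsep (yv v) s hs1 _ (cube_convex (cv v) s) hball hcube hbareQ (Fv v) (hFvc v)
  -- (iv) cross sums block × (everything else in the big cube)
  have hvout : ∀ v, -(κ / 32 * s ^ 3) ≤ ∑ y ∈ Fv v, ∑ w ∈ FQ \ Fv v, lennardJones (dist y w) := by
    intro v
    have hA : (↑(FQ \ Fv v) : Set (EuclideanSpace ℝ (Fin 3))) ⊆ Y \ ↑(Fv v) := by
      rw [Finset.coe_sdiff]
      exact fun z hz => ⟨hFQY hz.1, hz.2⟩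
    have h := hℓ₁ s (cv v) hsℓ₁ (Fv v) (hFvc v) (FQ \ Fv v) hA
    linarith [neg_sum_sum_abs_le (Fv v) (FQ \ Fv v) (fun y w => lennardJones (dist y w))]
  -- (v) each block holds at least s³/8 sites (covering radius)
  have hheavy : ∀ z : EuclideanSpace ℝ (Fin 3), ∃ q ∈ Y, dist q z < 2 / 2 ∧ (1 : ℝ) ≤ (fun _ : EuclideanSpace ℝ (Fin 3) => (1 : ℝ)) q := by
    intro z
    refine ⟨w z, hwY z, ?_, le_rfl⟩
    have := hwd z
    rw [dist_comm]; linarith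
  have hs3 : s ^ 3 / 8 = (n : ℝ) ^ 3 := by rw [hsdef]; ring
  have hN : ∀ v, s ^ 3 / 8 ≤ ((Fv v).card : ℝ) := by
    intro v
    have h := grid_lower_bound (fun _ : EuclideanSpace ℝ (Fin 3) => (1 : ℝ)) (fun _ _ => zero_le_one) two_pos hheavy n (cv v) (Fv v) (hFvc v)
    rw [hs3]
    simpa using h
  -- ── adding up: the pair sum of the big cube exceeds 2e·#F_Q by k³·κs³/8 ──
  have hS := sum_sum_blocks FQ Fv hFvsub hdisj (fun y w => lennardJones (dist y w))
  have hcard := card_blocks FQ Fv hFvsub hdisj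
  rw [← hRstdef] at hS hcard
  have hm : ((Fintype.card (Fin 3 → Fin k) : ℕ) : ℝ) = (k : ℝ) ^ 3 := by
    rw [Fintype.card_fun, Fintype.card_fin, Fintype.card_fin]; push_cast; ring
  have hsumRv : -(κ / 32 * s ^ 3) * (k : ℝ) ^ 3 ≤ ∑ v, ∑ y ∈ Rst, ∑ w ∈ Fv v, lennardJones (dist y w) := by
    have h := Finset.sum_le_sum (fun v (_ : v ∈ (Finset.univ : Finset (Fin 3 → Fin k))) => hRv v)
    rw [Finset.sum_const, Finset.card_univ, nsmul_eq_mul, hm] at h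
    linarith
  have hsumBlk : ∑ v, (2 * (e + κ) * ((Fv v).card : ℝ) - (2 * σ * s ^ 2 + κ / 32 * s ^ 3))
      ≤ ∑ v, (∑ y ∈ Fv v, ∑ w ∈ Fv v, lennardJones (dist y w) + ∑ y ∈ Fv v, ∑ w ∈ FQ \ Fv v, lennardJones (dist y w)) :=
    Finset.sum_le_sum (fun v _ => by linarith [hvv v, hvout v])
  have hsumL : ∑ v, (2 * (e + κ) * ((Fv v).card : ℝ) - (2 * σ * s ^ 2 + κ / 32 * s ^ 3))
      = 2 * (e + κ) * ∑ v, ((Fv v).card : ℝ) - (k : ℝ) ^ 3 * (2 * σ * s ^ 2 + κ / 32 * s ^ 3) := by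
    rw [Finset.sum_sub_distrib, ← Finset.mul_sum, Finset.sum_const, Finset.card_univ, nsmul_eq_mul, hm]
  have hsumN : (k : ℝ) ^ 3 * (s ^ 3 / 8) ≤ ∑ v, ((Fv v).card : ℝ) := by
    have h := Finset.sum_le_sum (fun v (_ : v ∈ (Finset.univ : Finset (Fin 3 → Fin k))) => hN v)
    rw [Finset.sum_const, Finset.card_univ, nsmul_eq_mul, hm] at h
    linarith
  have hκN := mul_le_mul_of_nonneg_left hsumN (by positivity : (0 : ℝ) ≤ 2 * κ)
  have hk0 : (0 : ℝ) ≤ (k : ℝ) ^ 3 := by positivity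
  have hσ2 : (k : ℝ) ^ 3 * (2 * σ * s ^ 2) ≤ (k : ℝ) ^ 3 * (κ * s ^ 3 / 16) := by
    apply mul_le_mul_of_nonneg_left _ hk0
    have h := mul_le_mul_of_nonneg_right hσs (sq_nonneg s)
    have h' : κ * s * s ^ 2 = κ * s ^ 3 := by ring
    linarith
  have hmain : 2 * e * (FQ.card : ℝ) + (k : ℝ) ^ 3 * (κ * s ^ 3 / 8) ≤ ∑ y ∈ FQ, ∑ w ∈ FQ, lennardJones (dist y w) := by
    rw [hS, hcard]
    linarith [hRR, hsumRv, hsumBlk, hsumL, hκN, hσ2]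
  -- ── the site charge of the big cube, two ways ──
  have hsplit : ∀ y ∈ FQ, (∑' w : ↥Y, lennardJones (dist y (w : EuclideanSpace ℝ (Fin 3)))) =
      (∑ w ∈ FQ, lennardJones (dist y w)) + ∑' w : ↥(Y \ ↑FQ), lennardJones (dist y (w : EuclideanSpace ℝ (Fin 3))) :=
    fun y _ => stub_siteSumSplit Y hUD FQ hFQY y
  have hch := (abs_le.1 (hℓ₃ ℓ c hℓ₃' FQ hFQ)).2
  have hX := (abs_le.1 (hℓ₂ ℓ c hℓ₂' FQ hFQ)).1
  rw [Finset.sum_sub_distrib, Finset.sum_congr rfl hsplit, Finset.sum_add_distrib] at hch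
  simp only [Finset.sum_const, nsmul_eq_mul] at hch
  have hη₀ℓ : η₀ * ℓ ^ 3 ≤ (k : ℝ) ^ 3 * (κ * s ^ 3 / 8) := by
    have hℓ3 : ℓ ^ 3 ≤ (2 * ((k : ℝ) * D)) ^ 3 := pow_le_pow_left₀ hℓ0.le hℓ2kD 3
    have h := mul_le_mul_of_nonneg_left hℓ3 (by positivity : (0 : ℝ) ≤ κ * s ^ 3)
    rw [hη₀def, div_mul_eq_mul_div, div_le_iff₀ (by positivity)]
    have h' : κ * s ^ 3 * (2 * ((k : ℝ) * D)) ^ 3 = (k : ℝ) ^ 3 * (κ * s ^ 3 / 8) * (64 * D ^ 3) := by ring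
    linarith
  have hpos : 0 < η₀ * ℓ ^ 3 := mul_pos hη₀ (pow_pos hℓ0 3)
  linarith

end Summit.AtomisticToContinuum.Crystallization.Theorems.OverbindingBudgetDeepBareExclusion
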